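import Mathlib
import Literature.Computability.AlgebraicComplexity.MatrixMultiplicationExponent
import Literature.Computability.AlgebraicComplexity.FlatteningBound
import Literature.Computability.AlgebraicComplexity.KroneckerRank

/-!
# MatrixMultiplication / ShapeSubmodularity — `ShapeSubmodular`, unit exchange on the boundary cells

Route `ShapeSubmodularity`, crux `ShapeSubmodular` (stmt-MatrixMultiplication-15622), line
`registered` (skeleton `Cruxes/ShapeSubmodular/Lines/birth.lean`), stub `stub_unitExchangeBoundary`.

Write `R(x,y,z)` for `n ↦ R⟨n^x, n^y, n^z⟩ = tensorRank (matMulTensor ℂ (n^x) (n^y) (n^z))`.  The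
unit-square exchange law in the first two format coordinates — admissible `β` for `R(a+1,b,c)` and
`β'` for `R(a,b+1,c)` give, for every `ε > 0`, admissible `γ` for `R(a+1,b+1,c)` and `γ'` for
`R(a,b,c)` with `γ + γ' ≤ β + β' + ε` — on the BOUNDARY cells `a = 0 ∨ b = 0 ∨ c = 0` of the
orthant.  There one of the formats is a matrix–vector / outer-product format whose rank is known
exactly (standard algorithm `R⟨k,m,n⟩ ≤ kmn` and the flattening lower bounds `km, mn, kn ≤ R⟨k,m,n⟩`),
and the law follows from BLOCKING `R⟨k, m·m', n⟩ ≤ m'·R⟨k,m,n⟩`, `R⟨k·k', m, n⟩ ≤ k'·R⟨k,m,n⟩`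
(Kronecker products with `⟨1,m',1⟩`, `⟨k',1,1⟩`; Bläser 2013, Lemma 5.8 and p. 24):

* `c = 0`: `γ = a+b+2`, `γ' = a+b` (standard algorithm), and flattening forces `a+b+1 ≤ β`,
  `a+b+1 ≤ β'`;
* `a = 0`: `γ = β+1` (blocking `R(1,b+1,c) ≤ n·R(1,b,c)`), `γ' = b+c`, and flattening forces
  `b+c+1 ≤ β'`;
* `b = 0`: `γ = β'+1` (blocking `R(a+1,1,c) ≤ n·R(a,1,c)`), `γ' = a+c`, and flattening forces
  `a+c+1 ≤ β`.
-/

-- the tree's namespace `Summit.MatrixMultiplication.MatrixMultiplication.…` repeats a component by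
-- design
set_option linter.dupNamespace false

open Filter Asymptotics
open Literature.Computability.AlgebraicComplexity

namespace Summit.MatrixMultiplication.MatrixMultiplication.Theorems.ShapeSubmodular

/-! ## `O`-bookkeeping for `ℕ`-valued sequences against real powers `n ↦ n^β` -/

/-- A polynomial upper bound `R n ≤ n^k` gives `R = O(n^k)` (real exponent `(k : ℝ)`). [folklore] -/
private theorem boundary_isBigO_of_le (R : ℕ → ℕ) (k : ℕ) (h : ∀ n : ℕ, R n ≤ n ^ k) :
    (fun n : ℕ => (R n : ℝ)) =O[atTop] (fun n : ℕ => (n : ℝ) ^ (k : ℝ)) := by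
  refine IsBigO.of_bound 1 (Eventually.of_forall fun n => ?_)
  rw [one_mul, Real.norm_of_nonneg (Nat.cast_nonneg _),
    Real.norm_of_nonneg (Real.rpow_nonneg (Nat.cast_nonneg _) _), Real.rpow_natCast]
  exact_mod_cast h n

/-- A polynomial lower bound forces the exponent: if `n^k ≤ R n` for `n ≥ 1` and `R = O(n^β)`, then
`k ≤ β` (otherwise `n^{k-β} → ∞` would be bounded). [folklore] -/
private theorem boundary_le_of_isBigO (R : ℕ → ℕ) (k : ℕ) (β : ℝ)
    (h : ∀ n : ℕ, 0 < n → n ^ k ≤ R n)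
    (hO : (fun n : ℕ => (R n : ℝ)) =O[atTop] (fun n : ℕ => (n : ℝ) ^ β)) :
    (k : ℝ) ≤ β := by
  -- adapted from `Literature.Computability.AlgebraicComplexity.admissibleExponents_two_le`
  by_contra hlt
  rw [not_le] at hlt
  obtain ⟨C, hC⟩ := isBigO_iff.1 hO
  have hev : ∀ᶠ n : ℕ in atTop, (n : ℝ) ^ ((k : ℝ) - β) ≤ C := by
    filter_upwards [hC, eventually_gt_atTop 0] with n hn hn0
    have hn0' : (0 : ℝ) < n := Nat.cast_pos.2 hn0
    rw [Real.norm_of_nonneg (Nat.cast_nonneg _),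
      Real.norm_of_nonneg (Real.rpow_nonneg (Nat.cast_nonneg _) _)] at hn
    have hsq : (n : ℝ) ^ (k : ℝ) ≤ C * (n : ℝ) ^ β := by
      refine le_trans ?_ hn
      rw [Real.rpow_natCast]
      exact_mod_cast h n hn0
    rw [Real.rpow_sub hn0', div_le_iff₀ (Real.rpow_pos_of_pos hn0' _)]
    exact hsq
  have hlim : Tendsto (fun n : ℕ => (n : ℝ) ^ ((k : ℝ) - β)) atTop atTop :=
    (tendsto_rpow_atTop (by linarith)).comp tendsto_natCast_atTop_atTop
  obtain ⟨n, hn₁, hn₂⟩ := (hev.and (hlim.eventually_gt_atTop C)).exists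
  exact absurd hn₁ (not_le.2 hn₂)

/-- One extra factor of `n`: if `R' n ≤ n · R n` and `R = O(n^β)`, then `R' = O(n^{β+1})`.
[folklore] -/
private theorem boundary_isBigO_mul (R R' : ℕ → ℕ) (β : ℝ) (h : ∀ n : ℕ, R' n ≤ n * R n)
    (hO : (fun n : ℕ => (R n : ℝ)) =O[atTop] (fun n : ℕ => (n : ℝ) ^ β)) :
    (fun n : ℕ => (R' n : ℝ)) =O[atTop] (fun n : ℕ => (n : ℝ) ^ (β + 1)) := by
  have h1 : (fun n : ℕ => (R' n : ℝ)) =O[atTop] (fun n : ℕ => (R n : ℝ) * (n : ℝ)) := by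
    refine IsBigO.of_bound 1 (Eventually.of_forall fun n => ?_)
    rw [one_mul, Real.norm_of_nonneg (Nat.cast_nonneg _), Real.norm_of_nonneg (by positivity)]
    calc (R' n : ℝ) ≤ ((n * R n : ℕ) : ℝ) := by exact_mod_cast h n
      _ = (R n : ℝ) * n := by push_cast; ring
  have h2 : (fun n : ℕ => (R n : ℝ) * (n : ℝ)) =O[atTop] (fun n : ℕ => (n : ℝ) ^ β * (n : ℝ)) :=
    hO.mul (isBigO_refl _ _)
  have h3 : (fun n : ℕ => (n : ℝ) ^ β * (n : ℝ)) =ᶠ[atTop] (fun n : ℕ => (n : ℝ) ^ (β + 1)) := by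
    filter_upwards [eventually_gt_atTop 0] with n hn0
    rw [Real.rpow_add_one (Nat.cast_pos.2 hn0).ne']
  exact (h1.trans h2).trans h3.isBigO

/-! ## Transport and blocking of matrix multiplication ranks -/

/-- Transport of the rank along equalities of the three formats. [folklore] -/
private theorem boundary_rank_congr {k k' m m' l l' : ℕ} (hk : k = k') (hm : m = m')
    (hl : l = l') :
    tensorRank (matMulTensor ℂ k m l) = tensorRank (matMulTensor ℂ k' m' l') := by
  subst hk; subst hm; subst hl; rfl

/-- Blocking in the inner dimension: `R⟨k, m·n, l⟩ ≤ n · R⟨k, m, l⟩` (Kronecker product with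
`⟨1, n, 1⟩`, whose rank is `≤ n` by the standard algorithm). [cite: Blaser2013, Lemma 5.8 and p. 24] -/
private theorem boundary_rank_mul_mid_le (k m l n : ℕ) :
    tensorRank (matMulTensor ℂ k (m * n) l) ≤ n * tensorRank (matMulTensor ℂ k m l) := by
  have h := Blaser2013_rank_matMulTensor_mul_le ℂ k m l 1 n 1
  rw [mul_one k, mul_one l] at h
  calc tensorRank (matMulTensor ℂ k (m * n) l)
        ≤ tensorRank (matMulTensor ℂ k m l) * tensorRank (matMulTensor ℂ 1 n 1) := h
    _ ≤ tensorRank (matMulTensor ℂ k m l) * n := by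
        refine Nat.mul_le_mul_left _ ?_
        simpa using tensorRank_matMulTensor_le ℂ 1 n 1
    _ = n * tensorRank (matMulTensor ℂ k m l) := mul_comm _ _

/-- Blocking in the first outer dimension: `R⟨k·n, m, l⟩ ≤ n · R⟨k, m, l⟩` (Kronecker product with
`⟨n, 1, 1⟩`, whose rank is `≤ n` by the standard algorithm). [cite: Blaser2013, Lemma 5.8 and p. 24] -/
private theorem boundary_rank_mul_left_le (k m l n : ℕ) :
    tensorRank (matMulTensor ℂ (k * n) m l) ≤ n * tensorRank (matMulTensor ℂ k m l) := by
  have h := Blaser2013_rank_matMulTensor_mul_le ℂ k m l n 1 1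
  rw [mul_one m, mul_one l] at h
  calc tensorRank (matMulTensor ℂ (k * n) m l)
        ≤ tensorRank (matMulTensor ℂ k m l) * tensorRank (matMulTensor ℂ n 1 1) := h
    _ ≤ tensorRank (matMulTensor ℂ k m l) * n := by
        refine Nat.mul_le_mul_left _ ?_
        simpa using tensorRank_matMulTensor_le ℂ n 1 1
    _ = n * tensorRank (matMulTensor ℂ k m l) := mul_comm _ _

/-! ## The stub -/

/-- **Unit exchange on the boundary of the orthant** (stub `stub_unitExchangeBoundary` of the line
`registered` of crux `ShapeSubmodular`): for `a = 0 ∨ b = 0 ∨ c = 0`, admissible exponents `β` for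
`R⟨n^(a+1), n^b, n^c⟩` and `β'` for `R⟨n^a, n^(b+1), n^c⟩` give, for every `ε > 0`, admissible `γ`
for `R⟨n^(a+1), n^(b+1), n^c⟩` and `γ'` for `R⟨n^a, n^b, n^c⟩` with `γ + γ' ≤ β + β' + ε`.  Proof by
the exact ranks of the matrix–vector / outer-product formats (standard algorithm + flattening) and
blocking (`Blaser2013_rank_matMulTensor_mul_le`). [folklore] -/
theorem stub_unitExchangeBoundary :
    ∀ a b c : ℕ, a = 0 ∨ b = 0 ∨ c = 0 → ∀ β β' : ℝ,
      (fun n : ℕ => (Literature.Computability.AlgebraicComplexity.tensorRank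
        (Literature.Computability.AlgebraicComplexity.matMulTensor ℂ (n ^ (a + 1)) (n ^ b) (n ^ c)) : ℝ))
          =O[Filter.atTop] (fun n : ℕ => (n : ℝ) ^ β) →
      (fun n : ℕ => (Literature.Computability.AlgebraicComplexity.tensorRank
        (Literature.Computability.AlgebraicComplexity.matMulTensor ℂ (n ^ a) (n ^ (b + 1)) (n ^ c)) : ℝ))
          =O[Filter.atTop] (fun n : ℕ => (n : ℝ) ^ β') →
      ∀ ε : ℝ, 0 < ε → ∃ γ γ' : ℝ, γ + γ' ≤ β + β' + ε ∧
        (fun n : ℕ => (Literature.Computability.AlgebraicComplexity.tensorRank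
          (Literature.Computability.AlgebraicComplexity.matMulTensor ℂ
            (n ^ (a + 1)) (n ^ (b + 1)) (n ^ c)) : ℝ))
            =O[Filter.atTop] (fun n : ℕ => (n : ℝ) ^ γ) ∧
        (fun n : ℕ => (Literature.Computability.AlgebraicComplexity.tensorRank
          (Literature.Computability.AlgebraicComplexity.matMulTensor ℂ (n ^ a) (n ^ b) (n ^ c)) : ℝ))
            =O[Filter.atTop] (fun n : ℕ => (n : ℝ) ^ γ') := by
  intro a b c h β β' h₁ h₂ ε hε
  rcases h with ha | hb | hc
  · -- `a = 0`: the second hypothesis format `⟨1, n^(b+1), n^c⟩` is an outer product of exact rank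
    subst ha
    have hβ' : ((b + c + 1 : ℕ) : ℝ) ≤ β' := by
      refine boundary_le_of_isBigO
        (fun n => tensorRank (matMulTensor ℂ (n ^ 0) (n ^ (b + 1)) (n ^ c))) (b + c + 1) β'
        (fun n hn => ?_) h₂
      haveI : NeZero (n ^ 0) := ⟨by simp⟩
      calc n ^ (b + c + 1) = n ^ (b + 1) * n ^ c := by ring
        _ ≤ tensorRank (matMulTensor ℂ (n ^ 0) (n ^ (b + 1)) (n ^ c)) :=
          mul_le_tensorRank_matMulTensor_right ℂ (n ^ 0) (n ^ (b + 1)) (n ^ c)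
    refine ⟨β + 1, ((b + c : ℕ) : ℝ), ?_, ?_, ?_⟩
    · push_cast at hβ' ⊢
      linarith
    · refine boundary_isBigO_mul
        (fun n => tensorRank (matMulTensor ℂ (n ^ (0 + 1)) (n ^ b) (n ^ c)))
        (fun n => tensorRank (matMulTensor ℂ (n ^ (0 + 1)) (n ^ (b + 1)) (n ^ c))) β
        (fun n => ?_) h₁
      calc tensorRank (matMulTensor ℂ (n ^ (0 + 1)) (n ^ (b + 1)) (n ^ c))
            = tensorRank (matMulTensor ℂ (n ^ (0 + 1)) (n ^ b * n) (n ^ c)) :=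
          boundary_rank_congr rfl (pow_succ n b) rfl
        _ ≤ n * tensorRank (matMulTensor ℂ (n ^ (0 + 1)) (n ^ b) (n ^ c)) :=
          boundary_rank_mul_mid_le _ _ _ _
    · refine boundary_isBigO_of_le
        (fun n => tensorRank (matMulTensor ℂ (n ^ 0) (n ^ b) (n ^ c))) (b + c) (fun n => ?_)
      calc tensorRank (matMulTensor ℂ (n ^ 0) (n ^ b) (n ^ c)) ≤ n ^ 0 * n ^ b * n ^ c :=
          tensorRank_matMulTensor_le ℂ _ _ _
        _ = n ^ (b + c) := by ring
  · -- `b = 0`: the first hypothesis format `⟨n^(a+1), 1, n^c⟩` is an outer product of exact rank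
    subst hb
    have hβ : ((a + c + 1 : ℕ) : ℝ) ≤ β := by
      refine boundary_le_of_isBigO
        (fun n => tensorRank (matMulTensor ℂ (n ^ (a + 1)) (n ^ 0) (n ^ c))) (a + c + 1) β
        (fun n hn => ?_) h₁
      haveI : NeZero (n ^ 0) := ⟨by simp⟩
      calc n ^ (a + c + 1) = n ^ (a + 1) * n ^ c := by ring
        _ ≤ tensorRank (matMulTensor ℂ (n ^ (a + 1)) (n ^ 0) (n ^ c)) :=
          mul_le_tensorRank_matMulTensor ℂ (n ^ (a + 1)) (n ^ 0) (n ^ c)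
    refine ⟨β' + 1, ((a + c : ℕ) : ℝ), ?_, ?_, ?_⟩
    · push_cast at hβ ⊢
      linarith
    · refine boundary_isBigO_mul
        (fun n => tensorRank (matMulTensor ℂ (n ^ a) (n ^ (0 + 1)) (n ^ c)))
        (fun n => tensorRank (matMulTensor ℂ (n ^ (a + 1)) (n ^ (0 + 1)) (n ^ c))) β'
        (fun n => ?_) h₂
      calc tensorRank (matMulTensor ℂ (n ^ (a + 1)) (n ^ (0 + 1)) (n ^ c))
            = tensorRank (matMulTensor ℂ (n ^ a * n) (n ^ (0 + 1)) (n ^ c)) :=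
          boundary_rank_congr (pow_succ n a) rfl rfl
        _ ≤ n * tensorRank (matMulTensor ℂ (n ^ a) (n ^ (0 + 1)) (n ^ c)) :=
          boundary_rank_mul_left_le _ _ _ _
    · refine boundary_isBigO_of_le
        (fun n => tensorRank (matMulTensor ℂ (n ^ a) (n ^ 0) (n ^ c))) (a + c) (fun n => ?_)
      calc tensorRank (matMulTensor ℂ (n ^ a) (n ^ 0) (n ^ c)) ≤ n ^ a * n ^ 0 * n ^ c :=
          tensorRank_matMulTensor_le ℂ _ _ _
        _ = n ^ (a + c) := by ring
  · -- `c = 0`: all four formats are matrix–vector formats of exact rank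
    subst hc
    have hβ : ((a + b + 1 : ℕ) : ℝ) ≤ β := by
      refine boundary_le_of_isBigO
        (fun n => tensorRank (matMulTensor ℂ (n ^ (a + 1)) (n ^ b) (n ^ 0))) (a + b + 1) β
        (fun n hn => ?_) h₁
      haveI : NeZero (n ^ 0) := ⟨by simp⟩
      calc n ^ (a + b + 1) = n ^ (a + 1) * n ^ b := by ring
        _ ≤ tensorRank (matMulTensor ℂ (n ^ (a + 1)) (n ^ b) (n ^ 0)) :=
          mul_le_tensorRank_matMulTensor_left ℂ (n ^ (a + 1)) (n ^ b) (n ^ 0)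
    have hβ' : ((a + b + 1 : ℕ) : ℝ) ≤ β' := by
      refine boundary_le_of_isBigO
        (fun n => tensorRank (matMulTensor ℂ (n ^ a) (n ^ (b + 1)) (n ^ 0))) (a + b + 1) β'
        (fun n hn => ?_) h₂
      haveI : NeZero (n ^ 0) := ⟨by simp⟩
      calc n ^ (a + b + 1) = n ^ a * n ^ (b + 1) := by ring
        _ ≤ tensorRank (matMulTensor ℂ (n ^ a) (n ^ (b + 1)) (n ^ 0)) :=
          mul_le_tensorRank_matMulTensor_left ℂ (n ^ a) (n ^ (b + 1)) (n ^ 0)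
    refine ⟨((a + b + 2 : ℕ) : ℝ), ((a + b : ℕ) : ℝ), ?_, ?_, ?_⟩
    · push_cast at hβ hβ' ⊢
      linarith
    · refine boundary_isBigO_of_le
        (fun n => tensorRank (matMulTensor ℂ (n ^ (a + 1)) (n ^ (b + 1)) (n ^ 0))) (a + b + 2)
        (fun n => ?_)
      calc tensorRank (matMulTensor ℂ (n ^ (a + 1)) (n ^ (b + 1)) (n ^ 0))
            ≤ n ^ (a + 1) * n ^ (b + 1) * n ^ 0 := tensorRank_matMulTensor_le ℂ _ _ _
        _ = n ^ (a + b + 2) := by ring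
    · refine boundary_isBigO_of_le
        (fun n => tensorRank (matMulTensor ℂ (n ^ a) (n ^ b) (n ^ 0))) (a + b) (fun n => ?_)
      calc tensorRank (matMulTensor ℂ (n ^ a) (n ^ b) (n ^ 0)) ≤ n ^ a * n ^ b * n ^ 0 :=
          tensorRank_matMulTensor_le ℂ _ _ _
        _ = n ^ (a + b) := by ring

end Summit.MatrixMultiplication.MatrixMultiplication.Theorems.ShapeSubmodular
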